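import Mathlib
import Summits.MatrixMultiplication.MatrixMultiplication.Theorems.PauliSmithLocalisationOrbitBound
import Literature.Computability.AlgebraicComplexity.TensorRestrictionRank

/-!
# Stub `stub_actAdd` for line `Sketch` of crux `FixedPointFreeTargets`
(stmt-MatrixMultiplication-15042)

The pinned Pauli sandwich action `act` of `E = ((ℤ/p)^k × (ℤ/p)^k)³` on tensors
`V = (I × I) → (I × I) → (I × I) → ℂ` (`I = Fin k → ZMod p`) is additive:
`act (g + h) = act g ∘ act h`.

Write `g = (g₁, g₂, g₃)`, `A = P g₁`, `B = P g₂`, `C = P g₃` for the Weyl–Heisenberg matrices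
(`P x z` has entry `χ(z ⬝ v)` at `(v + x, v)`, `χ m = exp (2πi m / p)` the standard character).
Then `act g` is the triple-kernel operator with Kronecker kernels
`Ka = Ā ⊗ₖ C`, `Kb = A ⊗ₖ B̄`, `Kc = B ⊗ₖ C̄` (bar = entrywise conjugate):
`act g x a b c = ∑ a' b' c', Ka a a' * Kb b b' * Kc c c' * x a' b' c'`.

* `kernel_comp`: composing two triple-kernel operators multiplies the kernels (sum gymnastics,
  as in `TensorRestrictsTo.trans`).
* `kron_conj_left_mul`, `kron_conj_right_mul`: by `(A ⊗ₖ C) (A' ⊗ₖ C') = AA' ⊗ₖ CC'` and the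
  Weyl rule `P_g P_h = χ(z_g ⬝ x_h) P_(g+h)` (`PauliOrbitBound.pauli_mul`), the product of two
  kernels of the same shape is a phase times the kernel of the sum.
* `phase_cancel`: the three phases appear once plain and once conjugated across the three slots,
  and `conj (χ m) * χ m = 1`, so the total scalar is `1` (`kernel_smul` pulls it out).
-/

set_option linter.dupNamespace false

noncomputable section

namespace Summit.MatrixMultiplication.MatrixMultiplication.Theorems

open scoped BigOperators ComplexConjugate Kronecker
open Matrix Literature.Computability.AlgebraicComplexity

namespace PauliTautologicalTarget

/-! ### Triple-kernel operators -/

/-- Composing two triple-kernel operators `x ↦ (a b c ↦ ∑ Ka a a' Kb b b' Kc c c' x a' b' c')`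
multiplies the three kernels. -/
theorem kernel_comp {J : Type*} [Fintype J] (Ka Kb Kc Ka' Kb' Kc' : Matrix J J ℂ)
    (x : J → J → J → ℂ) (a b c : J) :
    (∑ a', ∑ b', ∑ c', Ka a a' * Kb b b' * Kc c c' *
        ∑ a'', ∑ b'', ∑ c'', Ka' a' a'' * Kb' b' b'' * Kc' c' c'' * x a'' b'' c'') =
      ∑ a'', ∑ b'', ∑ c'', (Ka * Ka') a a'' * (Kb * Kb') b b'' * (Kc * Kc') c c'' *
        x a'' b'' c'' := by
  simp only [Matrix.mul_apply, Finset.mul_sum, Finset.sum_mul]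
  -- LHS binders `a' b' c' a'' b'' c''`, RHS binders `a'' b'' c'' c' b' a'`
  conv_lhs => rw [sum_comm₃]
  refine Finset.sum_congr rfl fun a'' _ => Finset.sum_congr rfl fun b'' _ =>
    Finset.sum_congr rfl fun c'' _ => ?_
  rw [sum_rev₃]
  refine Finset.sum_congr rfl fun _ _ => Finset.sum_congr rfl fun _ _ =>
    Finset.sum_congr rfl fun _ _ => ?_
  ring

/-- Scalars on the three kernels of a triple-kernel operator come out as their product. -/
theorem kernel_smul {J : Type*} [Fintype J] (c₁ c₂ c₃ : ℂ) (Ka Kb Kc : Matrix J J ℂ)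
    (x : J → J → J → ℂ) (a b c : J) :
    (∑ a', ∑ b', ∑ c', (c₁ • Ka) a a' * (c₂ • Kb) b b' * (c₃ • Kc) c c' * x a' b' c') =
      c₁ * c₂ * c₃ * ∑ a', ∑ b', ∑ c', Ka a a' * Kb b b' * Kc c c' * x a' b' c' := by
  simp only [Matrix.smul_apply, smul_eq_mul, Finset.mul_sum]
  refine Finset.sum_congr rfl fun _ _ => Finset.sum_congr rfl fun _ _ =>
    Finset.sum_congr rfl fun _ _ => ?_
  ring

/-! ### Phases -/

/-- Values of an additive character of `ZMod p` in `ℂ` are unimodular: `conj (χ m) * χ m = 1`. -/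
theorem conj_mul_addChar {p : ℕ} [NeZero p] (χ : AddChar (ZMod p) ℂ) (m : ZMod p) :
    starRingEnd ℂ (χ m) * χ m = 1 := by
  rw [← AddChar.map_neg_eq_conj, ← AddChar.map_add_eq_mul, neg_add_cancel,
    AddChar.map_zero_eq_one]

/-- **Phase cancellation**: the three projective phases of `act g ∘ act h` occur once plain and
once conjugated, so their product is `1`. -/
theorem phase_cancel {p : ℕ} [NeZero p] (χ : AddChar (ZMod p) ℂ) (m₁ m₂ m₃ : ZMod p) :
    starRingEnd ℂ (χ m₁) * χ m₃ * (χ m₁ * starRingEnd ℂ (χ m₂)) *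
      (χ m₂ * starRingEnd ℂ (χ m₃)) = 1 := by
  linear_combination (starRingEnd ℂ (χ m₂) * χ m₂ * (starRingEnd ℂ (χ m₃) * χ m₃)) *
    conj_mul_addChar χ m₁ + (starRingEnd ℂ (χ m₃) * χ m₃) * conj_mul_addChar χ m₂ +
    conj_mul_addChar χ m₃

/-! ### Weyl rule for the Kronecker kernels -/

section Pauli

variable {p : ℕ} [Fact p.Prime] {k : ℕ} {χ : AddChar (ZMod p) ℂ}
  {P : (Fin k → ZMod p) → (Fin k → ZMod p) → Matrix (Fin k → ZMod p) (Fin k → ZMod p) ℂ}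

/-- The Weyl multiplication rule `P_(x,z) P_(x',z') = χ(z ⬝ x') P_(x+x', z+z')`
(`PauliOrbitBound.pauli_mul`, unpacked arguments). -/
theorem pauli_mul' (hP : ∀ x z u v, P x z u v = if u = v + x then χ (z ⬝ᵥ v) else 0)
    (x z x' z' : Fin k → ZMod p) : P x z * P x' z' = χ (z ⬝ᵥ x') • P (x + x') (z + z') :=
  PauliOrbitBound.pauli_mul hP (x, z) (x', z')

/-- Product of two kernels `P̄ ⊗ₖ P`: a phase `conj χ(z₁ ⬝ y₁) * χ(z₂ ⬝ y₂)` times the kernel of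
the sum. -/
theorem kron_conj_left_mul (hP : ∀ x z u v, P x z u v = if u = v + x then χ (z ⬝ᵥ v) else 0)
    (x₁ z₁ x₂ z₂ y₁ w₁ y₂ w₂ : Fin k → ZMod p) :
    ((P x₁ z₁).map (starRingEnd ℂ) ⊗ₖ P x₂ z₂) * ((P y₁ w₁).map (starRingEnd ℂ) ⊗ₖ P y₂ w₂) =
      (starRingEnd ℂ (χ (z₁ ⬝ᵥ y₁)) * χ (z₂ ⬝ᵥ y₂)) •
        ((P (x₁ + y₁) (z₁ + w₁)).map (starRingEnd ℂ) ⊗ₖ P (x₂ + y₂) (z₂ + w₂)) := by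
  rw [← Matrix.mul_kronecker_mul, ← Matrix.map_mul, pauli_mul' hP, pauli_mul' hP,
    Matrix.map_smul' _ _ _ (map_mul (starRingEnd ℂ)), Matrix.smul_kronecker,
    Matrix.kronecker_smul, smul_smul]

/-- Product of two kernels `P ⊗ₖ P̄`: a phase `χ(z₁ ⬝ y₁) * conj χ(z₂ ⬝ y₂)` times the kernel of
the sum. -/
theorem kron_conj_right_mul (hP : ∀ x z u v, P x z u v = if u = v + x then χ (z ⬝ᵥ v) else 0)
    (x₁ z₁ x₂ z₂ y₁ w₁ y₂ w₂ : Fin k → ZMod p) :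
    (P x₁ z₁ ⊗ₖ (P x₂ z₂).map (starRingEnd ℂ)) * (P y₁ w₁ ⊗ₖ (P y₂ w₂).map (starRingEnd ℂ)) =
      (χ (z₁ ⬝ᵥ y₁) * starRingEnd ℂ (χ (z₂ ⬝ᵥ y₂))) •
        (P (x₁ + y₁) (z₁ + w₁) ⊗ₖ (P (x₂ + y₂) (z₂ + w₂)).map (starRingEnd ℂ)) := by
  rw [← Matrix.mul_kronecker_mul, ← Matrix.map_mul, pauli_mul' hP, pauli_mul' hP,
    Matrix.map_smul' _ _ _ (map_mul (starRingEnd ℂ)), Matrix.smul_kronecker,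
    Matrix.kronecker_smul, smul_smul]

end Pauli

/-! ### The stub -/

section Pinned

variable {p k : ℕ}
  {P : (Fin k → ZMod p) → (Fin k → ZMod p) → Matrix (Fin k → ZMod p) (Fin k → ZMod p) ℂ}
  {act : ((Fin k → ZMod p) × (Fin k → ZMod p)) × ((Fin k → ZMod p) × (Fin k → ZMod p)) ×
      ((Fin k → ZMod p) × (Fin k → ZMod p)) →
    (((Fin k → ZMod p) × (Fin k → ZMod p)) → ((Fin k → ZMod p) × (Fin k → ZMod p)) →
      ((Fin k → ZMod p) × (Fin k → ZMod p)) → ℂ) →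
    (((Fin k → ZMod p) × (Fin k → ZMod p)) → ((Fin k → ZMod p) × (Fin k → ZMod p)) →
      ((Fin k → ZMod p) × (Fin k → ZMod p)) → ℂ)}

/-- **The pinned sandwich action is additive**: `act (g + h) = act g ∘ act h`.  Each `act g` is
the triple-kernel operator with Kronecker kernels `P̄_g₁ ⊗ₖ P_g₃`, `P_g₁ ⊗ₖ P̄_g₂`, `P_g₂ ⊗ₖ P̄_g₃`;
composing multiplies the kernels (`kernel_comp`), the Weyl rule `P_g P_h = χ(z_g ⬝ x_h) P_(g+h)`
turns each product into a phase times the kernel of `g + h` (`kron_conj_left_mul`,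
`kron_conj_right_mul`), and the three phases cancel against their conjugates (`phase_cancel`). -/
theorem stub_actAdd [Fact p.Prime]
    (hP : ∀ x z u v, P x z u v = if u = v + x then
      Complex.exp (2 * Real.pi * Complex.I * ((∑ i, z i * v i).val : ℂ) / (p : ℂ)) else 0)
    (hact : ∀ g x a b c, act g x a b c = ∑ a', ∑ b', ∑ c',
      (starRingEnd ℂ (P g.1.1 g.1.2 a.1 a'.1) * P g.2.2.1 g.2.2.2 a.2 a'.2) *
      (P g.1.1 g.1.2 b.1 b'.1 * starRingEnd ℂ (P g.2.1.1 g.2.1.2 b.2 b'.2)) *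
      (P g.2.1.1 g.2.1.2 c.1 c'.1 * starRingEnd ℂ (P g.2.2.1 g.2.2.2 c.2 c'.2)) * x a' b' c')
    (g h : ((Fin k → ZMod p) × (Fin k → ZMod p)) × ((Fin k → ZMod p) × (Fin k → ZMod p)) ×
      ((Fin k → ZMod p) × (Fin k → ZMod p)))
    (x : ((Fin k → ZMod p) × (Fin k → ZMod p)) → ((Fin k → ZMod p) × (Fin k → ZMod p)) →
      ((Fin k → ZMod p) × (Fin k → ZMod p)) → ℂ) :
    act (g + h) x = act g (act h x) := by
  haveI : NeZero p := ⟨(Fact.out : p.Prime).ne_zero⟩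
  -- `P` is the Weyl–Heisenberg family of the standard character `m ↦ exp (2πi m / p)`
  have hP' : ∀ x z u v, P x z u v =
      if u = v + x then (ZMod.stdAddChar (N := p)) (z ⬝ᵥ v) else 0 := by
    intro x z u v
    rw [hP, ZMod.stdAddChar_apply, ZMod.toCircle_apply]
    rfl
  -- `act e` is the triple-kernel operator with Kronecker kernels `P̄ ⊗ₖ P`, `P ⊗ₖ P̄`, `P ⊗ₖ P̄`
  have hK : ∀ e y a b c, act e y a b c = ∑ a', ∑ b', ∑ c',
      ((P e.1.1 e.1.2).map (starRingEnd ℂ) ⊗ₖ P e.2.2.1 e.2.2.2) a a' *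
      (P e.1.1 e.1.2 ⊗ₖ (P e.2.1.1 e.2.1.2).map (starRingEnd ℂ)) b b' *
      (P e.2.1.1 e.2.1.2 ⊗ₖ (P e.2.2.1 e.2.2.2).map (starRingEnd ℂ)) c c' * y a' b' c' := by
    intro e y a b c
    rw [hact]
    rfl
  funext a b c
  simp only [hK]
  rw [kernel_comp, kron_conj_left_mul hP', kron_conj_right_mul hP', kron_conj_right_mul hP',
    kernel_smul, phase_cancel, one_mul]
  rfl

end Pinned

end PauliTautologicalTarget

end Summit.MatrixMultiplication.MatrixMultiplication.Theorems

end
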